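import Literature.IUT.HodgeTheaters.InitialThetaDataOfModelPlaces
import Literature.IUT.LogVolume.InitialThetaDataVolume
import Literature.IUT.LogVolume.PrincipalArithmeticDivisors
import Literature.NumberTheory.EllipticCurves.MultiplicativeReductionJValuationProofs
import Literature.NumberTheory.DiophantineGeometry.GenEllMellReduction
import HarnessLib

/-!
# [IUTchIV] Cor. 2.2 (ii) (P7) for ANY semistable curve — generic form of `InitialThetaDataOfModelPlaces.lean`

Mochizuki, *Inter-universal Teichmüller theory IV*, RIMS manuscript (Apr. 2020; = PRIMS **57** (2021)),
Cor. 2.2 (ii), proof, p. 45 (P2), p. 46 (P5) "`𝕍^bad_mod` … the nonarchimedean valuations ∈ 𝕍(F_mod) that do not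
divide `2l` and at which `E_F` has bad multiplicative reduction", (P6), (P7) "… all of the conditions of [IUTchI],
Definition 3.1, (a)–(f), are satisfied"; [IUTchI] Def. 3.1 (b)(c), pp. 61–62. `InitialThetaDataOfModelPlaces.lean`
(abc-iut-L5-t7 gen 4) proved this for `(F_mod(√−1, W[30]), W ⊗ F)`; the field of record is now the theta closure
field `F‡` with the LEGENDRE curve (abc-iut-plan 2026-08-26T02:59:03Z; findings F-L5t7-1, F-L5t7-2). The arguments
use only `j(E_F) ∈ F_mod = ℚ(j)`, semistability and `F/F_mod` Galois of degree prime to `l`, so THIS FILE (namespace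
`Literature.IUT.HodgeTheaters.Semistable`) re-proves them for an ARBITRARY elliptic curve `E` over a number field
`F` under exactly those hypotheses: `badSet`, `VbadModOf` (places of `F_mod` below the (P5) places),
`multiplicative_over_VbadModOf`, `l_coprime_qParamOrd_of`, `VbadModOf_odd/_ne_l`, `PlaceInput`, **`arithInputOf`**
(the `ArithInput` of `InitialThetaDataArith.lean`), `isP5Choice_of_VbadMod_eq`, **`exists_initialThetaData_of_placeInput`**
(initial Θ-data with `𝕍^bad_mod` the (P5) choice, modulo only the `π₁`-geometric interface). Classical; TAKES NO
SIDE on [IUTchIII] Cor. 3.12; nothing printed is asserted.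
-/

noncomputable section

open scoped Classical
open Field IntermediateField NumberField IsDedekindDomain
open Literature.NumberTheory.EllipticCurves Literature.IUT.LogVolume

namespace Literature.IUT.HodgeTheaters

namespace Semistable

variable {F : Type} [Field F] [NumberField F] (E : WeierstrassCurve F) [E.IsElliptic]

/-! ## `j(E_F)` as an element of the field of moduli; valuations in the tower `F_mod ⊆ F` -/

/-- `j(E_F) = algebraMap F_mod F (jMod)` (`ThetaData.jMod E = ⟨j, _⟩ ∈ ℚ(j(E_F)) = F_mod`).
[claim: Mochizuki2012, status: disputed] -/
theorem algebraMap_jModE : algebraMap (fieldOfModuli E) F (ThetaData.jMod E) = E.j :=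
  rfl

/-- **`ord_v(j) = e(v|u)·ord_u(j)`** for `v` a finite place of `F` over the place `u` of `F_mod` (`j ∈ F_mod`).
[claim: Mochizuki2012, status: disputed] -/
theorem ord_j_eq_mul (v : HeightOneSpectrum (𝓞 F)) :
    ord F v E.j =
      Ideal.ramificationIdx' (finBelow (fieldOfModuli E) F v).asIdeal v.asIdeal *
        ord (fieldOfModuli E) (finBelow (fieldOfModuli E) F v) (ThetaData.jMod E) := by
  rw [← algebraMap_jModE E, ord_algebraMap]

/-- The ramification index of a finite place is positive. [claim: Mochizuki2012, status: disputed] -/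
theorem ramificationIdx'_pos (v : HeightOneSpectrum (𝓞 F)) :
    0 < Ideal.ramificationIdx' (finBelow (fieldOfModuli E) F v).asIdeal v.asIdeal := by
  haveI := v.isPrime
  exact Nat.pos_of_ne_zero (Ideal.IsDedekindDomain.ramificationIdx'_ne_zero_of_liesOver v.asIdeal
    (finBelow (fieldOfModuli E) F v).ne_bot)

/-- Places of `F` over the SAME place of `F_mod` see the same sign of `ord(j)` (`j ∈ F_mod`).
[claim: Mochizuki2012, status: disputed] -/
theorem ord_j_neg_iff_of_finBelow_eq {v w : HeightOneSpectrum (𝓞 F)}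
    (h : finBelow (fieldOfModuli E) F v =
      finBelow (fieldOfModuli E) F w) :
    ord F v E.j < 0 ↔ ord F w E.j < 0 := by
  rw [ord_j_eq_mul E v, ord_j_eq_mul E w, h,
    mul_neg_iff_of_pos (by exact_mod_cast (h ▸ ramificationIdx'_pos E v)),
    mul_neg_iff_of_pos (by exact_mod_cast ramificationIdx'_pos E w)]

/-! ## The (P5) bad places of `F`, their images `V^bad_mod` in `F_mod`, and the Def. 3.1 (b)(c) clauses -/

/-- The (P5) places of `F` for the prime `l`: bad multiplicative reduction, not over `2`, not over `l`
([IUTchIV] Cor. 2.2 (ii), (P5), p. 46: "the nonarchimedean valuations … that do not divide `2l` and at which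
`E_F` has bad multiplicative reduction"). [claim: Mochizuki2012, status: disputed] -/
def badSet (l : ℕ) : Set (HeightOneSpectrum (𝓞 F)) :=
  {w | E.HasMultiplicativeReductionAt w ∧ ((2 : ℕ) : 𝓞 F) ∉ w.asIdeal ∧
    ((l : ℕ) : 𝓞 F) ∉ w.asIdeal}

/-- `𝕍^bad_mod :=` the places of `F_mod` below the (P5) places of `F` ((P5): "`𝕍^bad_mod` … of `F_mod`").
[claim: Mochizuki2012, status: disputed] -/
def VbadModOf (l : ℕ) : Set (FinitePlace (fieldOfModuli E)) :=
  (fun w => InitialThetaData.finBelow (E := E) (FinitePlace.mk w)) '' badSet E l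

/-- Restriction of a nonarchimedean valuation of `F` to `F_mod` is the place below it.
[claim: Mochizuki2012, status: disputed] -/
theorem restrict_non_eq (x : FinitePlace F) :
    Val.restrict (fieldOfModuli E) (Val.non x) =
      Val.non (InitialThetaData.finBelow (E := E) x) := rfl

/-- A place of `F` restricts into `Val.non '' 𝕍^bad_mod` iff it lies over the same place of `F_mod` as some
(P5) place. [claim: Mochizuki2012, status: disputed] -/
theorem restrict_mem_iff {l : ℕ} (x : FinitePlace F) :
    Val.restrict (fieldOfModuli E) (Val.non x) ∈ Val.non '' VbadModOf E l ↔
      ∃ w ∈ badSet E l, InitialThetaData.finBelow (E := E) x =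
        InitialThetaData.finBelow (E := E) (FinitePlace.mk w) := by
  rw [restrict_non_eq]
  constructor
  · rintro ⟨u, ⟨w, hw, rfl⟩, hu⟩
    exact ⟨w, hw, (Sum.inr_injective hu).symm⟩
  · rintro ⟨w, hw, h⟩
    exact ⟨_, ⟨w, hw, rfl⟩, congrArg Val.non h.symm⟩

/-- Equal places below in `F_mod` (as `FinitePlace`s) give equal primes below in `𝓞 F_mod`.
[claim: Mochizuki2012, status: disputed] -/
theorem finBelow_eq_of_finBelow_mk_eq {x : FinitePlace F} {w : HeightOneSpectrum (𝓞 F)}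
    (h : InitialThetaData.finBelow (E := E) x =
      InitialThetaData.finBelow (E := E) (FinitePlace.mk w)) :
    finBelow (fieldOfModuli E) F x.maximalIdeal =
      finBelow (fieldOfModuli E) F w := by
  unfold InitialThetaData.finBelow at h
  have h' := congrArg FinitePlace.maximalIdeal h
  rw [FinitePlace.maximalIdeal_mk, FinitePlace.maximalIdeal_mk, FinitePlace.maximalIdeal_mk] at h'
  exact h'

/-- **(b) bad multiplicative reduction of `E_F` at EVERY place of `F` over `𝕍^bad_mod`** (not only at the
(P5) places themselves: conjugate places over the same place of `F_mod` have `ord(j)` of the same sign, and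
`E_F` is semistable). [claim: Mochizuki2012, status: disputed] -/
theorem multiplicative_over_VbadModOf (hss : E.IsSemistable (𝓞 F)) {l : ℕ} (x : FinitePlace F)
    (hx : Val.restrict (fieldOfModuli E) (Val.non x) ∈ Val.non '' VbadModOf E l) :
    E.HasMultiplicativeReductionAt x.maximalIdeal := by
  obtain ⟨w, hw, h⟩ := (restrict_mem_iff E x).mp hx
  refine hasMultiplicativeReductionAt_of_ord_j_neg E hss ?_
  rw [ord_j_neg_iff_of_finBelow_eq E (finBelow_eq_of_finBelow_mk_eq E h)]
  exact ord_j_neg_of_hasMultiplicativeReductionAt' E hw.1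

/-- In the Galois extension `F/F_mod` the ramification index `e(v|u)` divides `[F : F_mod]`.
[claim: Mochizuki2012, status: disputed] -/
theorem ramificationIdx'_dvd_finrank [IsGalois (fieldOfModuli E) F] (v : HeightOneSpectrum (𝓞 F)) :
    Ideal.ramificationIdx' (finBelow (fieldOfModuli E) F v).asIdeal v.asIdeal ∣
      Module.finrank (fieldOfModuli E) F := by
  set u := finBelow (fieldOfModuli E) F v
  haveI := v.isPrime
  haveI := u.isPrime
  rw [Ideal.ramificationIdx'_eq_ramificationIdx (p := u.asIdeal) (q := v.asIdeal) u.ne_bot]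
  have h := Ideal.ncard_primesOver_mul_ramificationIdxIn_mul_inertiaDegIn u.asIdeal (𝓞 F)
    Gal(F/fieldOfModuli E)
  rw [Ideal.ramificationIdxIn_eq_ramificationIdx u.asIdeal v.asIdeal Gal(F/fieldOfModuli E),
    IsGaloisGroup.card_eq_finrank Gal(F/fieldOfModuli E)
      (fieldOfModuli E) F] at h
  exact ⟨(u.asIdeal.primesOver (𝓞 F)).ncard * u.asIdeal.inertiaDegIn (𝓞 F),
    by rw [← h]; ring⟩

/-- **(c) `l` is prime to the local heights `ord_v(q) = ord_v(Δ_min)` at every place over `𝕍^bad_mod`**, from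
(P2) at the (P5) places: over the common place `u` of `F_mod`, `ord_v(j) = e(v|u)·ord_u(j)` with `l ∤ ord_u(j)`
and `l ∤ e(v|u) ∣ [F:F_mod]` (`l ≥ 7`). [claim: Mochizuki2012, status: disputed] -/
theorem l_coprime_qParamOrd_of [IsGalois (fieldOfModuli E) F] (hss : E.IsSemistable (𝓞 F)) {l : ℕ}
    (hl : l.Prime) (hcop : (Module.finrank (fieldOfModuli E) F).Coprime l)
    (hP2 : ∀ w ∈ badSet E l, ¬ ((l : ℤ) ∣ ord F w E.j))
    (x : FinitePlace F)
    (hx : Val.restrict (fieldOfModuli E) (Val.non x) ∈ Val.non '' VbadModOf E l) :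
    l.Coprime (qParamOrd E x.maximalIdeal) := by
  obtain ⟨w, hw, h⟩ := (restrict_mem_iff E x).mp hx
  have hmult := multiplicative_over_VbadModOf E hss x hx
  rw [Nat.Prime.coprime_iff_not_dvd hl]
  intro hdvd
  -- `l ∣ ord(Δ_min) = −ord_x(j)`
  have hlog : (l : ℤ) ∣ WithZero.log ((x.maximalIdeal).valuation F E.j) :=
    (E.natCast_dvd_log_valuation_j_iff x.maximalIdeal hmult l).mpr hdvd
  have hordx : (l : ℤ) ∣ ord F x.maximalIdeal E.j := by
    unfold ord; exact (dvd_neg).mpr hlog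
  -- decompose along the common place below
  have hbelow := finBelow_eq_of_finBelow_mk_eq E h
  rw [ord_j_eq_mul E x.maximalIdeal, hbelow] at hordx
  have hordw := hP2 w hw
  rw [ord_j_eq_mul E w] at hordw
  -- `l ∤ ord_u(j)`
  have hu : ¬ ((l : ℤ) ∣ ord (fieldOfModuli E)
      (finBelow (fieldOfModuli E) F w) (ThetaData.jMod E)) :=
    fun hd => hordw (dvd_mul_of_dvd_right hd _)
  -- `l ∤ e(x|u)`
  have he : ¬ ((l : ℤ) ∣ (Ideal.ramificationIdx'
      (finBelow (fieldOfModuli E) F x.maximalIdeal).asIdeal x.maximalIdeal.asIdeal : ℤ)) := by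
    intro hd
    have hd' : l ∣ Ideal.ramificationIdx'
        (finBelow (fieldOfModuli E) F x.maximalIdeal).asIdeal x.maximalIdeal.asIdeal := by
      exact_mod_cast hd
    have hfin := (ramificationIdx'_dvd_finrank E x.maximalIdeal)
    have : l ∣ Module.finrank (fieldOfModuli E) F := hd'.trans hfin
    exact (Nat.Prime.coprime_iff_not_dvd hl).mp hcop.symm this
  rw [hbelow] at he
  have hprime : Prime (l : ℤ) := Int.prime_iff_natAbs_prime.mpr (by simpa using hl)
  rcases hprime.dvd_or_dvd hordx with h1 | h2
  · exact he h1
  · exact hu h2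

/-! ## Residue characteristics at the bad places: odd and `≠ l` -/

/-- The residue characteristic of the place of `F_mod` below a finite place `w` of `F` equals the characteristic
of `𝓞_F / w` (the residue field extension is injective). [claim: Mochizuki2012, status: disputed] -/
theorem residueChar_finBelow_eq (w : HeightOneSpectrum (𝓞 F)) :
    residueChar (InitialThetaData.finBelow (E := E) (FinitePlace.mk w)) =
      ringChar (𝓞 F ⧸ w.asIdeal) := by
  unfold residueChar InitialThetaData.finBelow
  rw [FinitePlace.maximalIdeal_mk, FinitePlace.maximalIdeal_mk]
  -- the residue ring of `F_mod` at the place below embeds into `𝓞_F / w`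
  change ringChar (𝓞 (fieldOfModuli E) ⧸ w.asIdeal.under (𝓞 (fieldOfModuli E))) = _
  have hinj : Function.Injective (algebraMap
      (𝓞 (fieldOfModuli E) ⧸ w.asIdeal.under (𝓞 (fieldOfModuli E)))
      (𝓞 F ⧸ w.asIdeal)) :=
    FaithfulSMul.algebraMap_injective _ _
  haveI : CharP (𝓞 F ⧸ w.asIdeal) (ringChar (𝓞 F ⧸ w.asIdeal)) := ringChar.charP _
  haveI := (RingHom.charP_iff _ hinj (ringChar (𝓞 F ⧸ w.asIdeal))).mpr this
  exact ringChar.eq _ (ringChar (𝓞 F ⧸ w.asIdeal))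

omit [NumberField F] [E.IsElliptic] in
/-- `(n : 𝓞_F/w) = 0 ↔ n ∈ w`. [claim: Mochizuki2012, status: disputed] -/
theorem natCast_quotient_eq_zero_iff (w : HeightOneSpectrum (𝓞 F)) (n : ℕ) :
    ((n : ℕ) : 𝓞 F ⧸ w.asIdeal) = 0 ↔ ((n : ℕ) : 𝓞 F) ∈ w.asIdeal := by
  rw [← map_natCast (Ideal.Quotient.mk w.asIdeal), Ideal.Quotient.eq_zero_iff_mem]

/-- The characteristic of `𝓞_F/w` is an odd prime when `2 ∉ w`. [claim: Mochizuki2012, status: disputed] -/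
theorem odd_ringChar_quotient (w : HeightOneSpectrum (𝓞 F))
    (h2 : ((2 : ℕ) : 𝓞 F) ∉ w.asIdeal) : Odd (ringChar (𝓞 F ⧸ w.asIdeal)) := by
  set R := 𝓞 F ⧸ w.asIdeal
  set p := ringChar R with hp
  haveI := w.isMaximal
  -- `p ≠ 0`: the (nonzero) absolute norm of `w` dies in `R`
  have hN : ((Ideal.absNorm w.asIdeal : ℕ) : R) = 0 := by
    rw [← map_natCast (Ideal.Quotient.mk w.asIdeal), Ideal.Quotient.eq_zero_iff_mem]
    exact Ideal.absNorm_mem w.asIdeal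
  have hN0 : Ideal.absNorm w.asIdeal ≠ 0 := by
    rw [Ne, Ideal.absNorm_eq_zero_iff]; exact w.ne_bot
  have hp0 : p ≠ 0 := by
    intro h0
    rw [ringChar.spec, ← hp, h0, zero_dvd_iff] at hN
    exact hN0 hN
  have hprime : p.Prime := (CharP.char_is_prime_or_zero R p).resolve_right hp0
  have hp2 : p ≠ 2 := by
    intro h
    have : ((2 : ℕ) : R) = 0 := by rw [ringChar.spec, ← hp, h]
    exact h2 ((natCast_quotient_eq_zero_iff w 2).mp this)
  exact hprime.odd_of_ne_two hp2

omit [NumberField F] [E.IsElliptic] in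
/-- The characteristic of `𝓞_F/w` is not `l` when `l ∉ w`. [claim: Mochizuki2012, status: disputed] -/
theorem ringChar_quotient_ne (w : HeightOneSpectrum (𝓞 F)) {l : ℕ}
    (hl : ((l : ℕ) : 𝓞 F) ∉ w.asIdeal) : ringChar (𝓞 F ⧸ w.asIdeal) ≠ l := by
  intro h
  have : ((l : ℕ) : 𝓞 F ⧸ w.asIdeal) = 0 := by rw [ringChar.spec, h]
  exact hl ((natCast_quotient_eq_zero_iff w l).mp this)

/-- **(b) odd residue characteristics on `𝕍^bad_mod`** ((P5): the bad places do not divide `2`).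
[claim: Mochizuki2012, status: disputed] -/
theorem VbadModOf_odd {l : ℕ} (u : FinitePlace (fieldOfModuli E)) (hu : u ∈ VbadModOf E l) :
    Odd (residueChar u) := by
  obtain ⟨w, hw, rfl⟩ := hu
  rw [residueChar_finBelow_eq]
  exact odd_ringChar_quotient w hw.2.1

/-- **(c) `l` is prime to the residue characteristics of `𝕍^bad_mod`** ((P5): the bad places do not divide `l`).
[claim: Mochizuki2012, status: disputed] -/
theorem VbadModOf_ne_l {l : ℕ} (u : FinitePlace (fieldOfModuli E)) (hu : u ∈ VbadModOf E l) :
    residueChar u ≠ l := by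
  obtain ⟨w, hw, rfl⟩ := hu
  rw [residueChar_finBelow_eq]
  exact ringChar_quotient_ne w hw.2.2

/-! ## Assembly -/

/-- The `F`-level inputs of (P7): `l ≥ 7` prime, ONE (P5) place, (P2) at the (P5) places, (P6) over `F`.
[claim: Mochizuki2012, status: disputed] -/
structure PlaceInput (l : ℕ) where
  /-- `l` prime -/
  l_prime : l.Prime
  /-- `l ≥ 7` -/
  seven_le_l : 7 ≤ l
  /-- (P5): some bad multiplicative place of `F` not dividing `2l` -/
  exists_bad : (badSet E l).Nonempty
  /-- (P2) at the (P5) places: `l ∤ ord_w(j) = −h_w` -/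
  not_dvd_ord : ∀ w ∈ badSet E l, ¬ ((l : ℤ) ∣ ord F w E.j)
  /-- (P6) over `F` -/
  imageContainsSL2 : ImageContainsSL2 (AlgebraicClosure F) E l

/-- **The arithmetic input of [IUTchI] Def. 3.1 for a semistable `E_F` over a number field `F` Galois of degree
prime to `l` over `F_mod`, with `√−1 ∈ F` and `E_F[30] ⊆ E_F(F)`**, from the `F`-level (P2)/(P5)/(P6) data:
`𝕍^bad_mod :=` the places of `F_mod` below the (P5) places. [claim: Mochizuki2012, status: disputed] -/
def arithInputOf [IsGalois (fieldOfModuli E) F] (hi : ∃ i : F, i ^ 2 = -1)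
    (h30 : ∀ T : GeomPoints (AlgebraicClosure F) E, (30 : ℤ) • T = 0 →
      T ∈ Set.range (WeierstrassCurve.Affine.Point.baseChange (W' := E.toAffine) F (AlgebraicClosure F)))
    {l : ℕ} (hcop : (Module.finrank (fieldOfModuli E) F).Coprime l) (I : PlaceInput E l) : ArithInput E l :=
  have hss : E.IsSemistable (𝓞 F) :=
    E.isSemistable_of_torsion_rational_fifteen fun T hT => by
      have hT30 : (30 : ℤ) • T = 0 := by
        rw [show (30 : ℤ) = 2 * 15 by norm_num, mul_smul, hT, smul_zero]
      exact h30 T hT30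
  { sqrt_neg_one_mem := hi
    torsion_thirty_rational := h30
    VbadMod := VbadModOf E l
    VbadMod_nonempty := by
      obtain ⟨w, hw⟩ := I.exists_bad
      exact ⟨_, w, hw, rfl⟩
    VbadMod_odd := fun u hu => VbadModOf_odd E u hu
    multiplicative_over_VbadMod := fun v hv => multiplicative_over_VbadModOf E hss v hv
    isGalois_fieldOfModuli := inferInstance
    finrank_coprime := hcop
    l_prime := I.l_prime
    five_le_l := le_trans (by norm_num) I.seven_le_l
    imageContainsSL2 := I.imageContainsSL2
    l_ne_residueChar := fun u hu => VbadModOf_ne_l E u hu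
    l_coprime_qParamOrd := fun v hv => l_coprime_qParamOrd_of E hss I.l_prime hcop I.not_dvd_ord v hv }

/-- `n ∈ 𝔪_x ↔ n ∈ 𝔪_w` when `x` and `w` lie over the same place of `F_mod` (same residue characteristic).
[claim: Mochizuki2012, status: disputed] -/
theorem natCast_mem_iff_of_finBelow_eq {x : FinitePlace F} {w : HeightOneSpectrum (𝓞 F)}
    (h : InitialThetaData.finBelow (E := E) x = InitialThetaData.finBelow (E := E) (FinitePlace.mk w)) (n : ℕ) :
    ((n : ℕ) : 𝓞 F) ∈ x.maximalIdeal.asIdeal ↔ ((n : ℕ) : 𝓞 F) ∈ w.asIdeal := by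
  have hchar : ringChar (𝓞 F ⧸ x.maximalIdeal.asIdeal) = ringChar (𝓞 F ⧸ w.asIdeal) := by
    rw [← residueChar_finBelow_eq E w, ← residueChar_finBelow_eq E x.maximalIdeal, FinitePlace.mk_maximalIdeal, h]
  rw [← natCast_quotient_eq_zero_iff x.maximalIdeal n, ← natCast_quotient_eq_zero_iff w n, ringChar.spec,
    ringChar.spec, hchar]

/-- **`𝕍^bad_mod :=` the places of `F_mod` under the (P5) places IS the (P5) choice** (`ThetaData.IsP5Choice`,
abc-iut-c312-8's point dictionary): a finite place of `F` lies over it iff it divides neither `2` nor `l` and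
`E_F` is multiplicative there. [cite: Mochizuki2012, IUTchIV Cor 2.2 proof (P5) p.46] -/
theorem isP5Choice_of_VbadMod_eq (hss : E.IsSemistable (𝓞 F)) {K Fbar : Type} [Field K] [NumberField K]
    [Algebra F K] [Field Fbar] [Algebra F Fbar] [Algebra K Fbar] {l : ℕ} {Pb : BadPlacePredicates K}
    (D : InitialThetaData F K Fbar E l Pb) (hD : D.VbadMod = VbadModOf E l) : ThetaData.IsP5Choice D := by
  intro v
  change Val.restrict (fieldOfModuli E) (Val.non v) ∈ Val.non '' D.VbadMod ↔ _
  rw [hD, restrict_mem_iff E v]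
  constructor
  · rintro ⟨w, hw, h⟩
    refine ⟨fun p hp => ?_, multiplicative_over_VbadModOf E hss v ((restrict_mem_iff E v).mpr ⟨w, hw, h⟩)⟩
    simp only [Finset.mem_insert, Finset.mem_singleton] at hp
    rcases hp with rfl | rfl
    · rw [natCast_mem_iff_of_finBelow_eq E h]; exact hw.2.1
    · rw [natCast_mem_iff_of_finBelow_eq E h]; exact hw.2.2
  · rintro ⟨hp, hmult⟩
    refine ⟨v.maximalIdeal, ⟨hmult, hp 2 (by simp), hp l (by simp)⟩, ?_⟩
    rw [FinitePlace.mk_maximalIdeal]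

/-- **EXISTENCE of initial Θ-data on a semistable `E_F`** (given `√−1 ∈ F`, `E_F[30]` rational, `F/F_mod` Galois of
degree prime to `l`, and the `F`-level (P2)/(P5)/(P6) data), with `𝕍^bad_mod` the places under the (P5) places
AND the (P5) choice, modulo the `π₁`-geometric interface of [IUTchI] Def. 3.1 (d)(e)(f) only.
[claim: Mochizuki2012, status: disputed] -/
theorem exists_initialThetaData_of_placeInput [IsGalois (fieldOfModuli E) F] (hi : ∃ i : F, i ^ 2 = -1)
    (h30 : ∀ T : GeomPoints (AlgebraicClosure F) E, (30 : ℤ) • T = 0 →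
      T ∈ Set.range (WeierstrassCurve.Affine.Point.baseChange (W' := E.toAffine) F (AlgebraicClosure F)))
    {l : ℕ} [NeZero l] (hcop : (Module.finrank (fieldOfModuli E) F).Coprime l) (I : PlaceInput E l)
    (Pb : BadPlacePredicates (TorsionField E l))
    (geom : ThetaGeometry.{0} (AlgebraicClosure F ≃ₐ[F] AlgebraicClosure F)
      (galoisSubgroupOf F (TorsionField E l) (AlgebraicClosure F)) l)
    (hbad_type : ∀ w : Val (TorsionField E l),
      toVMod F (TorsionField E l) E w ∈ Val.non '' VbadModOf E l → Pb.IsTypeOneZModLPM w)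
    (hbad_cusp : ∀ w : Val (TorsionField E l),
      toVMod F (TorsionField E l) E w ∈ Val.non '' VbadModOf E l → Pb.IsCanonicalGeneratorCusp w) :
    ∃ D : InitialThetaData F (TorsionField E l) (AlgebraicClosure F) E l Pb,
      D.VbadMod = VbadModOf E l ∧ ThetaData.IsP5Choice D := by
  have hss : E.IsSemistable (𝓞 F) := (arithInputOf E hi h30 hcop I).isSemistable
  obtain ⟨D, hD⟩ := InitialThetaData.exists_ofArith E l (arithInputOf E hi h30 hcop I) Pb geom hbad_type hbad_cusp
  exact ⟨D, hD, isP5Choice_of_VbadMod_eq E hss D hD⟩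

end Semistable

end Literature.IUT.HodgeTheaters

end
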